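import Mathlib
import Literature.NumberTheory.LFunctions.Zhang2022.Section16CalM2Euler
import Literature.NumberTheory.LFunctions.Zhang2022.AppendixALemma161Bridge
import Literature.Analysis.Complex.HolomorphicProducts
import HarnessLib

/-!
# Zhang (2022) §16 Lemma 16.2 (repaired, GAP row G-d57-1): the value arithmetic —
# the Euler product `∏_q F_q` of the main term `(6/π²)·φ(D)/(D𝔭)·∏_{q∣D} q/(q+1)` of `𝔲₂ⱼ(1)`

Topic `Literature/NumberTheory/LFunctions/Zhang2022` (Landau–Siegel audit tree; verdict-neutral).
Y. Zhang, *Discrete mean estimates and the Landau–Siegel zero*, arXiv:2211.02515v1 (2022)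
[Zhang2022LandauSiegel] — **an unrefereed manuscript under adjudication; nothing here asserts or
denies its Theorems 1–2 or anything about Landau–Siegel zeros.** ZHANG-L discharge lane, WP16
BLOCK D (Lemma 16.2 = App. A §A.u039–u042, row G-d57-1), helper D-5′ of WP09-PLAN §10.3 (seat
zl-w09-p6 for zl-w09-p4 / zl-w16-p8, under the leaf `Typed.Section16B.Eq16_16`).

§16 p. 94 (tex L4652) states `𝔲₂ⱼ(1) = (6/π²)·φ(D)/(D𝔭)·∏_{q∣D} q/(q+1) + O(𝓛⁻⁴)`
(`Typed.Section16B.frakU2Main`), with `𝔭` the Euler product of Lemma 16.1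
(`frakp = frakpA = ∏_q (1−χ(q)q⁻¹)⁻¹(1−χ(q)/(q−1))` if `χ(2) ≠ 1`, `= frakpB = 2∏_{q>2}(…)` if
`χ(2) = 1`; `frakpFactor`). The Appendix-A computation of `𝔲₂ⱼ(1)` produces it as an EULER PRODUCT,
prime by prime; this file supplies that bookkeeping as ONE `HasProd` statement over `Nat.Primes`:

* `hasProd_frakU2Main` — for a quadratic `χ` mod `D`,
  `∏_q F_q = frakU2Main χ`, `F_q = (1−q⁻¹)²` (`q ∣ D`), `= 3/8` (`q = 2`, `χ(2) = 1`),
  `= (1−q⁻²)/frakpFactor χ q` (otherwise).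

Ingredients: `∏_q(1−q⁻²) = 6/π²` (Mathlib `riemannZeta_eulerProduct_hasProd` at `s = 2`,
`riemannZeta_two`, inverted factorwise); `frakpFactor χ q = 1` for `q ∣ D` (`χ(q) = 0`),
`|frakpFactor χ q − 1| ≤ 4/q²` (`AppendixA.norm_locMain_sub_one_le` via
`AppendixA.frakpFactor_eq_locMain`), `frakpFactor χ q ≠ 0` unless `q = 2 ∧ χ(2) = 1`
(then the factor of `frakpB` at `2` is `1` and `F_2 = 3/8 = (1−¼)·½` carries the `2` of `frakpB`);
convergence and non-vanishing of `∏' frakpFactor` by `Literature.Analysis.Complex`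
(`multipliable_of_summable_norm_sub_one`, `tprod_ne_zero_of_summable_norm_sub_one`); and the finite
identity `∏_{q∣D}(1−q⁻¹)²/(1−q⁻²) = (φ(D)/D)·∏_{q∣D} q/(q+1)` (`Nat.totient_mul_prod_primeFactors`).

Theorem-only; no definitions, no new facts; (A) is not used.

## References

* Y. Zhang, arXiv:2211.02515v1 (2022), §16 Lemmas 16.1–16.2 pp. 92–94 (tex L4579–L4590, L4646–L4653),
  App. A §A.u039–u042 p. 105. [cite: Zhang2022LandauSiegel, §16 Lemma 16.2 p.94]
-/

noncomputable section

open Complex Real Filter Topology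

namespace Literature.NumberTheory.LFunctions.Zhang2022.Typed.Section16B

open Literature.NumberTheory.LFunctions.Zhang2022
open Literature.NumberTheory.LFunctions.Zhang2022.Skeleton

variable {D : ℕ} [NeZero D] (χ : DirichletCharacter ℂ D)

/-! ## The local factor `frakpFactor` -/

omit [NeZero D] in
/-- `χ(q) = 0` for a prime `q ∣ D` (`q` is not a unit mod `D`). [folklore] -/
private theorem chi_eq_zero_of_dvd {q : ℕ} (hq : q.Prime) (hqD : q ∣ D) : χ (q : ZMod D) = 0 := by
  apply χ.map_nonunit
  rw [ZMod.isUnit_iff_coprime]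
  intro hcop
  have h1 : q ∣ Nat.gcd q D := Nat.dvd_gcd dvd_rfl hqD
  rw [hcop] at h1
  exact hq.one_lt.ne' (Nat.dvd_one.mp h1)

omit [NeZero D] in
/-- For a prime `q ∣ D`: `frakpFactor χ q = 1`. [cite: Zhang2022LandauSiegel, §16 Lemma 16.1 p.92] -/
theorem frakpFactor_of_dvd {q : ℕ} (hq : q.Prime) (hqD : q ∣ D) : frakpFactor χ q = 1 := by
  rw [frakpFactor, chi_eq_zero_of_dvd χ hq hqD]
  simp

omit [NeZero D] in
/-- `|frakpFactor χ q − 1| ≤ 4/q²` for a prime `q` (any character: `|χ(q)| ≤ 1`).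
[cite: Zhang2022LandauSiegel, §16 Lemma 16.1 p.92] -/
theorem norm_frakpFactor_sub_one_le {q : ℕ} (hq : q.Prime) :
    ‖frakpFactor χ q - 1‖ ≤ 4 / (q : ℝ) ^ 2 := by
  rw [AppendixA.frakpFactor_eq_locMain]
  exact AppendixA.norm_locMain_sub_one_le (χ.norm_le_one _) hq.two_le

omit [NeZero D] in
/-- `frakpFactor χ q ≠ 0` for a prime `q` and a quadratic `χ`, unless `q = 2` and `χ(2) = 1`.
[cite: Zhang2022LandauSiegel, §16 Lemma 16.1 p.92] -/
theorem frakpFactor_ne_zero (hχ : χ.IsQuadratic) {q : ℕ} (hq : q.Prime)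
    (h2 : ¬ (q = 2 ∧ χ (2 : ZMod D) = 1)) : frakpFactor χ q ≠ 0 := by
  have hq2 : (2 : ℝ) ≤ q := by exact_mod_cast hq.two_le
  have hq0 : (q : ℂ) ≠ 0 := by exact_mod_cast hq.ne_zero
  have hv : ‖χ (q : ZMod D)‖ ≤ 1 := χ.norm_le_one _
  rw [frakpFactor]
  refine mul_ne_zero (inv_ne_zero ?_) ?_
  · -- `1 − χ(q)/q ≠ 0`: `|χ(q)/q| ≤ 1/2`
    intro h
    have h1 : χ (q : ZMod D) * (q : ℂ)⁻¹ = 1 := by linear_combination -h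
    have hn : ‖χ (q : ZMod D) * (q : ℂ)⁻¹‖ ≤ 1 / 2 := by
      rw [norm_mul, norm_inv, Complex.norm_natCast]
      calc ‖χ (q : ZMod D)‖ * (q : ℝ)⁻¹ ≤ 1 * (q : ℝ)⁻¹ := by gcongr
        _ ≤ 1 / 2 := by rw [one_mul]; exact inv_le_of_inv_le₀ (by norm_num) (by linarith)
    rw [h1, norm_one] at hn
    norm_num at hn
  · -- `1 − χ(q)/(q−1) ≠ 0` unless `q = 2`, `χ(2) = 1`
    intro h
    have hq1 : (q : ℂ) - 1 ≠ 0 := by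
      have : (1 : ℝ) ≤ (q : ℝ) - 1 := by linarith
      intro h0
      have := congrArg Complex.re h0
      simp at this
      linarith
    have h1 : χ (q : ZMod D) = (q : ℂ) - 1 := by
      field_simp at h
      linear_combination -h
    rcases hχ (q : ZMod D) with h0 | h0 | h0
    · rw [h0] at h1
      have := congrArg Complex.re h1; simp at this; linarith
    · -- `χ(q) = 1 = q − 1` forces `q = 2`
      rw [h0] at h1
      have hre := congrArg Complex.re h1
      simp at hre
      have hq' : (q : ℝ) = 2 := by linarith
      have hqeq : q = 2 := by exact_mod_cast hq'
      apply h2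
      refine ⟨hqeq, ?_⟩
      have : ((2 : ℕ) : ZMod D) = (2 : ZMod D) := by norm_cast
      rw [← this, ← hqeq]; exact h0
    · rw [h0] at h1
      have := congrArg Complex.re h1; simp at this; linarith

/-- Summability of `4/q²` over the primes. [folklore] -/
private theorem summable_four_div_sq : Summable (fun q : Nat.Primes => 4 / ((q : ℕ) : ℝ) ^ 2) := by
  have h := (Nat.Primes.summable_rpow.mpr (by norm_num : (-2 : ℝ) < -1)).mul_left 4
  refine h.congr fun q => ?_
  have hq0 : (0 : ℝ) < (q : ℕ) := by exact_mod_cast q.prop.pos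
  rw [Real.rpow_neg hq0.le, show (2 : ℝ) = ((2 : ℕ) : ℝ) by norm_num, Real.rpow_natCast,
    div_eq_mul_inv]

/-! ## `∏_q (1 − q⁻²) = 6/π²` -/

/-- An Euler product with non-vanishing value may be inverted factorwise. [folklore] -/
private theorem hasProd_inv_of_ne_zero' {ι : Type*} {f : ι → ℂ} {a : ℂ} (hf : HasProd f a)
    (ha : a ≠ 0) : HasProd (fun i => (f i)⁻¹) a⁻¹ := by
  classical
  have hT : Tendsto (fun A : Finset ι => ∏ i ∈ A, f i) atTop (𝓝 a) := hf
  have hT' := hT.inv₀ ha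
  have hfun : (fun A : Finset ι => ∏ i ∈ A, (f i)⁻¹) = fun A => (∏ i ∈ A, f i)⁻¹ := by
    funext A; rw [Finset.prod_inv_distrib]
  show Tendsto (fun A : Finset ι => ∏ i ∈ A, (f i)⁻¹) atTop (𝓝 a⁻¹)
  rw [hfun]; exact hT'

/-- **`∏_q (1 − q⁻²) = 6/π²`** over the primes (Euler; Mathlib's Euler product of `ζ` at `s = 2`
and `ζ(2) = π²/6`). [cite: Zhang2022LandauSiegel, §15 p.88; §16 p.94] -/
theorem hasProd_one_sub_inv_sq :
    HasProd (fun q : Nat.Primes => 1 - ((((q : ℕ) : ℂ)) ^ 2)⁻¹) (((6 / Real.pi ^ 2 : ℝ)) : ℂ) := by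
  have hζ := riemannZeta_eulerProduct_hasProd (s := 2) (by norm_num)
  have hne : riemannZeta 2 ≠ 0 := by
    rw [riemannZeta_two]
    exact div_ne_zero (pow_ne_zero 2 (by exact_mod_cast Real.pi_ne_zero)) (by norm_num)
  have h := hasProd_inv_of_ne_zero' hζ hne
  have hfun : (fun q : Nat.Primes => ((1 - ((q : ℕ) : ℂ) ^ (-(2 : ℂ)))⁻¹)⁻¹) =
      fun q : Nat.Primes => 1 - ((((q : ℕ) : ℂ)) ^ 2)⁻¹ := by
    funext q
    rw [inv_inv, Complex.cpow_neg, show (2 : ℂ) = ((2 : ℕ) : ℂ) by norm_num, Complex.cpow_natCast]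
  have hval : (riemannZeta 2)⁻¹ = (((6 / Real.pi ^ 2 : ℝ)) : ℂ) := by
    rw [riemannZeta_two]; push_cast; rw [inv_div]
  rw [hfun, hval] at h
  exact h

/-! ## The finite part at the primes dividing `D` -/

/-- `(1 − q⁻¹)²/(1 − q⁻²) = (q−1)/(q+1)` for `q ≥ 2`. [folklore] -/
private theorem sq_div_eq {q : ℕ} (hq : 2 ≤ q) :
    (1 - ((q : ℂ))⁻¹) ^ 2 / (1 - (((q : ℂ)) ^ 2)⁻¹) = ((q : ℂ) - 1) / ((q : ℂ) + 1) := by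
  have hq' : (2 : ℝ) ≤ q := by exact_mod_cast hq
  have hq0 : (q : ℂ) ≠ 0 := by exact_mod_cast (show q ≠ 0 by omega)
  have hq1 : (q : ℂ) + 1 ≠ 0 := by
    intro h; have := congrArg Complex.re h; simp at this; linarith
  have hqm : (q : ℂ) - 1 ≠ 0 := by
    intro h; have := congrArg Complex.re h; simp at this; linarith
  have hsq : (q : ℂ) ^ 2 - 1 ≠ 0 := by
    have : (q : ℂ) ^ 2 - 1 = ((q : ℂ) - 1) * ((q : ℂ) + 1) := by ring
    rw [this]; exact mul_ne_zero hqm hq1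
  field_simp
  ring

omit [NeZero D] χ in
/-- **`∏_{q∣D}(1−q⁻¹)²/(1−q⁻²) = (φ(D)/D)·∏_{q∣D} q/(q+1)`** (Euler's `φ(D)/D = ∏_{q∣D}(1 − 1/q)`).
[cite: Zhang2022LandauSiegel, §16 Lemma 16.2 p.94] -/
theorem prod_primeFactors_sq_div_eq (hD : D ≠ 0) :
    ∏ q ∈ D.primeFactors, (1 - ((q : ℂ))⁻¹) ^ 2 / (1 - (((q : ℂ)) ^ 2)⁻¹) =
      (Nat.totient D : ℂ) / (D : ℂ) * ∏ q ∈ D.primeFactors, ((q : ℂ) / ((q : ℂ) + 1)) := by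
  have hprime : ∀ q ∈ D.primeFactors, q.Prime := fun q hq => Nat.prime_of_mem_primeFactors hq
  -- `φ(D)·∏ q = D·∏ (q − 1)` in `ℂ`
  have htot := congrArg (fun n : ℕ => (n : ℂ)) (Nat.totient_mul_prod_primeFactors D)
  simp only [Nat.cast_mul, Nat.cast_prod] at htot
  have hsub : ∀ q ∈ D.primeFactors, (((q - 1 : ℕ)) : ℂ) = (q : ℂ) - 1 := fun q hq => by
    rw [Nat.cast_sub (hprime q hq).one_le, Nat.cast_one]
  rw [Finset.prod_congr rfl hsub] at htot
  have hD0 : (D : ℂ) ≠ 0 := by exact_mod_cast hD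
  have hP0 : ∏ q ∈ D.primeFactors, (q : ℂ) ≠ 0 :=
    Finset.prod_ne_zero_iff.mpr fun q hq => by exact_mod_cast (hprime q hq).ne_zero
  have hP1 : ∏ q ∈ D.primeFactors, ((q : ℂ) + 1) ≠ 0 :=
    Finset.prod_ne_zero_iff.mpr fun q hq => by
      intro h; have := congrArg Complex.re h; simp at this
      linarith [show (0:ℝ) ≤ (q:ℝ) from Nat.cast_nonneg q]
  have hφ : (Nat.totient D : ℂ) / (D : ℂ) =
      (∏ q ∈ D.primeFactors, ((q : ℂ) - 1)) / ∏ q ∈ D.primeFactors, (q : ℂ) := by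
    rw [div_eq_div_iff hD0 hP0]
    linear_combination htot
  rw [Finset.prod_congr rfl fun q hq => sq_div_eq (hprime q hq).two_le, hφ,
    Finset.prod_div_distrib, Finset.prod_div_distrib, div_mul_div_comm, mul_comm (∏ q ∈ D.primeFactors, ((q : ℂ) - 1)),
    ← div_mul_div_comm, div_self hP0, one_mul]

/-! ## The main statement -/

open scoped Classical in
/-- **The Euler product of the main term of `𝔲₂ⱼ(1)`** (Lemma 16.2, repaired reading; the value
arithmetic of App. A §A.u039–u042): for a quadratic `χ` mod `D`, the product over all primes of
`F_q = (1−q⁻¹)²` (`q ∣ D`), `3/8` (`q = 2`, `χ(2) = 1`), `(1−q⁻²)/((1−χ(q)q⁻¹)⁻¹(1−χ(q)/(q−1)))`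
(otherwise) converges to `(6/π²)·φ(D)/(D𝔭)·∏_{q∣D} q/(q+1) = frakU2Main χ`.
[cite: Zhang2022LandauSiegel, §16 Lemma 16.2 p.94] -/
theorem hasProd_frakU2Main (hχ : χ.IsQuadratic) :
    HasProd (fun q : Nat.Primes => if (q : ℕ) ∣ D then (1 - ((q : ℕ) : ℂ)⁻¹) ^ 2
      else if (q : ℕ) = 2 ∧ χ (2 : ZMod D) = 1 then (3 / 8 : ℂ)
      else (1 - (((q : ℕ) : ℂ) ^ 2)⁻¹) / frakpFactor χ q) (frakU2Main χ) := by
  have hD : D ≠ 0 := NeZero.ne D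
  -- (1) `Z_q = 1 − q⁻²`, product `6/π²`
  have hZ := hasProd_one_sub_inv_sq
  -- (2) the finite part `G₁`
  set g₁ : ℕ → ℂ := fun n =>
    if n ∣ D then (1 - (n : ℂ)⁻¹) ^ 2 / (1 - ((n : ℂ) ^ 2)⁻¹) else 1 with hg₁
  set G₁ : Nat.Primes → ℂ := fun q => g₁ (q : ℕ) with hG₁
  set S : Finset Nat.Primes := D.primeFactors.subtype Nat.Prime with hS
  have hmemS : ∀ q : Nat.Primes, q ∈ S ↔ (q : ℕ) ∣ D := by
    intro q
    constructor
    · intro h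
      exact (Nat.mem_primeFactors.mp (Finset.mem_subtype.mp h)).2.1
    · intro h
      exact Finset.mem_subtype.mpr (Nat.mem_primeFactors.mpr ⟨q.prop, h, hD⟩)
  have hG₁off : ∀ q ∉ S, G₁ q = 1 := by
    intro q hq
    rw [hG₁]; dsimp only; rw [hg₁]; dsimp only
    rw [if_neg (fun h => hq ((hmemS q).mpr h))]
  have hG₁prod : HasProd G₁ (∏ q ∈ S, G₁ q) := hasProd_prod_of_ne_finset_one hG₁off
  have hG₁val : ∏ q ∈ S, G₁ q =
      (Nat.totient D : ℂ) / (D : ℂ) * ∏ q ∈ D.primeFactors, ((q : ℂ) / ((q : ℂ) + 1)) := by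
    rw [← prod_primeFactors_sq_div_eq hD]
    have h1 : ∏ q ∈ S, G₁ q = ∏ q ∈ D.primeFactors.filter Nat.Prime, g₁ q :=
      Finset.prod_subtype_eq_prod_filter g₁
    rw [h1, Finset.filter_true_of_mem fun q hq => Nat.prime_of_mem_primeFactors hq]
    refine Finset.prod_congr rfl fun q hq => ?_
    rw [hg₁]; dsimp only
    rw [if_pos (Nat.dvd_of_mem_primeFactors hq)]
  -- (3) the `𝔭`-part `G₂`, product `𝔭⁻¹`
  set G₂ : Nat.Primes → ℂ := fun q =>
    if (q : ℕ) ∣ D then 1 else if (q : ℕ) = 2 ∧ χ (2 : ZMod D) = 1 then (1 / 2 : ℂ)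
      else (frakpFactor χ q)⁻¹ with hG₂
  have hG₂prod : HasProd G₂ (frakp χ)⁻¹ := by
    by_cases h2 : χ (2 : ZMod D) = 1
    · -- case `χ(2) = 1`: `𝔭 = frakpB = 2·∏' g`, `g(2) = 1`
      set g : Nat.Primes → ℂ := fun q => if (q : ℕ) = 2 then 1 else frakpFactor χ q with hg
      have hgsub : ∀ q : Nat.Primes, ‖g q - 1‖ ≤ 4 / ((q : ℕ) : ℝ) ^ 2 := by
        intro q; rw [hg]; dsimp only
        split_ifs with h
        · simp; positivity
        · exact norm_frakpFactor_sub_one_le χ q.prop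
      have hgsum : Summable fun q : Nat.Primes => ‖g q - 1‖ :=
        Summable.of_nonneg_of_le (fun _ => norm_nonneg _) hgsub summable_four_div_sq
      have hgne : ∀ q : Nat.Primes, g q ≠ 0 := by
        intro q; rw [hg]; dsimp only
        split_ifs with h
        · exact one_ne_zero
        · exact frakpFactor_ne_zero χ hχ q.prop (fun hh => h hh.1)
      have hgmul : Multipliable g := Literature.Analysis.Complex.multipliable_of_summable_norm_sub_one hgsum
      have hgtne : ∏' q, g q ≠ 0 :=
        Literature.Analysis.Complex.tprod_ne_zero_of_summable_norm_sub_one hgsum hgne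
      have hginv : HasProd (fun q => (g q)⁻¹) (∏' q, g q)⁻¹ := hasProd_inv_of_ne_zero' hgmul.hasProd hgtne
      -- the extra factor `1/2` at `q = 2`
      set H : Nat.Primes → ℂ := fun q => if (q : ℕ) = 2 then (1 / 2 : ℂ) else 1 with hH
      let two : Nat.Primes := ⟨2, Nat.prime_two⟩
      have hHoff : ∀ q ∉ ({two} : Finset Nat.Primes), H q = 1 := by
        intro q hq
        rw [hH]; dsimp only
        rw [if_neg]
        intro h
        apply hq
        rw [Finset.mem_singleton]
        exact Subtype.ext h
      have hHprod : HasProd H (∏ q ∈ ({two} : Finset Nat.Primes), H q) :=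
        hasProd_prod_of_ne_finset_one hHoff
      rw [Finset.prod_singleton] at hHprod
      have hH2 : H two = 1 / 2 := by rw [hH]; dsimp only; rw [if_pos rfl]
      rw [hH2] at hHprod
      have hprod := hginv.mul hHprod
      have hfun : (fun q => (g q)⁻¹ * H q) = G₂ := by
        funext q
        rw [hg, hH, hG₂]; dsimp only
        by_cases hqD : (q : ℕ) ∣ D
        · rw [if_pos hqD]
          have hq2 : (q : ℕ) ≠ 2 := by
            intro hq
            have : χ (2 : ZMod D) = 0 := by
              have := chi_eq_zero_of_dvd χ q.prop hqD
              rw [hq] at this; exact_mod_cast this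
            rw [this] at h2; exact zero_ne_one h2
          rw [if_neg hq2, if_neg hq2, frakpFactor_of_dvd χ q.prop hqD]; simp
        · rw [if_neg hqD]
          by_cases hq : (q : ℕ) = 2
          · rw [if_pos hq, if_pos hq, if_pos ⟨hq, h2⟩]; simp
          · rw [if_neg hq, if_neg hq, if_neg (fun hh => hq hh.1), mul_one]
      have hval : (∏' q, g q)⁻¹ * (1 / 2 : ℂ) = (frakp χ)⁻¹ := by
        rw [frakp, if_neg (not_not.mpr h2), frakpB, mul_inv]
        ring
      rw [hfun, hval] at hprod
      exact hprod
    · -- case `χ(2) ≠ 1`: `𝔭 = frakpA = ∏' frakpFactor`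
      set g : Nat.Primes → ℂ := fun q => frakpFactor χ q with hg
      have hgsub : ∀ q : Nat.Primes, ‖g q - 1‖ ≤ 4 / ((q : ℕ) : ℝ) ^ 2 :=
        fun q => norm_frakpFactor_sub_one_le χ q.prop
      have hgsum : Summable fun q : Nat.Primes => ‖g q - 1‖ :=
        Summable.of_nonneg_of_le (fun _ => norm_nonneg _) hgsub summable_four_div_sq
      have hgne : ∀ q : Nat.Primes, g q ≠ 0 :=
        fun q => frakpFactor_ne_zero χ hχ q.prop (fun hh => h2 hh.2)
      have hgmul : Multipliable g := Literature.Analysis.Complex.multipliable_of_summable_norm_sub_one hgsum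
      have hgtne : ∏' q, g q ≠ 0 :=
        Literature.Analysis.Complex.tprod_ne_zero_of_summable_norm_sub_one hgsum hgne
      have hginv : HasProd (fun q => (g q)⁻¹) (∏' q, g q)⁻¹ := hasProd_inv_of_ne_zero' hgmul.hasProd hgtne
      have hfun : (fun q => (g q)⁻¹) = G₂ := by
        funext q
        rw [hg, hG₂]; dsimp only
        by_cases hqD : (q : ℕ) ∣ D
        · rw [if_pos hqD, frakpFactor_of_dvd χ q.prop hqD, inv_one]
        · rw [if_neg hqD, if_neg (fun hh => h2 hh.2)]
      have hval : (∏' q, g q)⁻¹ = (frakp χ)⁻¹ := by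
        rw [frakp, if_pos h2, frakpA]
      rw [hfun, hval] at hginv
      exact hginv
  -- (4) assemble `F = Z · G₁ · G₂`
  have hprod := (hZ.mul hG₁prod).mul hG₂prod
  have hfun : (fun q : Nat.Primes => (1 - ((((q : ℕ) : ℂ)) ^ 2)⁻¹) * G₁ q * G₂ q) =
      fun q : Nat.Primes => if (q : ℕ) ∣ D then (1 - ((q : ℕ) : ℂ)⁻¹) ^ 2
        else if (q : ℕ) = 2 ∧ χ (2 : ZMod D) = 1 then (3 / 8 : ℂ)
        else (1 - (((q : ℕ) : ℂ) ^ 2)⁻¹) / frakpFactor χ q := by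
    funext q
    rw [hG₁, hG₂]; dsimp only; rw [hg₁]; dsimp only
    have hq2 : (2 : ℝ) ≤ (q : ℕ) := by exact_mod_cast q.prop.two_le
    have hZne : (1 : ℂ) - ((((q : ℕ) : ℂ)) ^ 2)⁻¹ ≠ 0 := by
      have hq0 : (((q : ℕ) : ℂ)) ^ 2 ≠ 0 := pow_ne_zero 2 (by exact_mod_cast q.prop.ne_zero)
      intro h
      have h1 : (((q : ℕ) : ℂ)) ^ 2 = 1 := by
        have := sub_eq_zero.mp h
        rw [eq_comm, inv_eq_one] at this
        exact this
      have := congrArg Complex.re h1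
      simp [sq] at this
      nlinarith
    by_cases hqD : (q : ℕ) ∣ D
    · rw [if_pos hqD, if_pos hqD, if_pos hqD, mul_one, mul_div_cancel₀ _ hZne]
    · rw [if_neg hqD, if_neg hqD, if_neg hqD, mul_one]
      by_cases hq : (q : ℕ) = 2 ∧ χ (2 : ZMod D) = 1
      · rw [if_pos hq, if_pos hq, hq.1]; norm_num
      · rw [if_neg hq, if_neg hq, div_eq_mul_inv]
  have hval : (((6 / Real.pi ^ 2 : ℝ)) : ℂ) *
      ((Nat.totient D : ℂ) / (D : ℂ) * ∏ q ∈ D.primeFactors, ((q : ℂ) / ((q : ℂ) + 1))) *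
        (frakp χ)⁻¹ = frakU2Main χ := by
    rw [frakU2Main]
    rw [div_mul_eq_div_div]
    ring
  rw [hG₁val] at hprod
  rw [hfun, hval] at hprod
  exact hprod

end Literature.NumberTheory.LFunctions.Zhang2022.Typed.Section16B

end
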